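import Summits.Ventures.CertifiedQuantumChemistry.Rows.OrbitalSignBlockingLossless
import Summits.Ventures.CertifiedQuantumChemistry.Rows.SpinFlipQuotientLosslessT
import HarnessLib

/-!
# Ventures/CertifiedQuantumChemistry — Rows/OrbitalSignBlockingLosslessT.lean: the abelian point-group
# (sign-character) blocking of the sector programme is LOSSLESS at the `DQGT1T2′` rung

HONEST FRAMING (verbatim): certified bounds for a stated model Hamiltonian in a stated basis; not a
claim about the real molecule beyond that model.

Seat rdm-B (generator B, FORMAT-qcl1 §8 `ORBSYM` hints), ROWS courtesy file (theorems only; no `def`, no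
notation); the three-index companion of `Rows/OrbitalSignBlockingLossless.lean` (DQG rung), in the shape of
`Rows/SpinFlipQuotientLosslessT.lean` (the `M = 0` flip quotient at the `DQGT1T2′` rung). The cell's
strongest certified rows (`DQGT1T2′`, e.g. CERTIFIED #152–#154 and the `SZ1-T2P` legs) are sector
programmes whose instances generator B emits WITH the §8 orbital-sign block structure; this file proves
that imposing that structure as CONSTRAINTS loses nothing at the `DQGT1T2′` rung either:

* `ite_eq_sign_mul_one` — under a Kronecker delta a sign character may be inserted:
  `δ_ab = χ_a χ_b δ_ab` (`χ = ±1`), the one-line mechanism behind every covariance below;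
* `t1Map_sign`, `t2Map_sign`, `t2PrimeMap_sign` — the `T1`, `T2` functionals (Nakata et al. 2008 §II.A,
  33 resp. 7 printed terms) and the `T2′` block matrix (§II.B) of an abstract pair are COVARIANT under
  the sign congruence `γ_ik ↦ χ_i χ_k γ_ik`, `Γ_pq ↦ χ_{p₁} χ_{p₂} χ_{q₁} χ_{q₂} Γ_pq`: the three-index
  matrices transform by the diagonal sign `χ_i χ_j χ_k` (and `χ_l` on the one-index corner of `T2′`).
  Proof: insert `χ_a χ_b` under every delta of the transformed side (`conv_lhs`), after which both
  sides are the SAME commutative polynomial in the signs, the deltas and the entries (`ring`) — no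
  case split over the `2⁶` sign patterns or the `2⁹` delta patterns is needed;
* `isDQGT1T2PrimeFeasible_sign`, `isDQGT1T2PrimeFeasibleSector_sign` — hence the `N`-electron and the
  `S_z`-sector `DQGT1T2′`-feasible sets are INVARIANT under every sign congruence
  (`posSemidef_diagMul` for the two new cones; the DQG part is `isDQGFeasible(Sector)_sign`);
* **`exists_signSymmetric_of_isDQGT1T2PrimeFeasibleSector`** — LOSSLESS, `DQGT1T2′` rung: when the
  integral tables obey the SELECTION RULE of spin-independent orbital signs `s_p = ±1` (`h_pq = 0`
  unless `s_p s_q = 1`, `g_pqrs = 0` unless `s_p s_r s_q s_s = 1`; abelian point group, Mazziotti 2007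
  §II.F eq. (95)), every sector-`DQGT1T2′`-feasible pair has a SIGN-SYMMETRIC sector-`DQGT1T2′`-feasible
  partner (entries with an odd sign product vanish) with the SAME energy — its `ℤ₂` average
  (`isDQGT1T2PrimeFeasibleSector_midpoint`, `rdmEnergy_midpoint`, `rdmEnergy_sign`);
* **`forall_isDQGT1T2PrimeFeasibleSector_iff_forall_signSymmetric`** — bound form: a real number lies
  below the energy functional on ALL sector-`DQGT1T2′`-feasible pairs iff it lies below it on the
  sign-symmetric ones, i.e. the symmetry-blocked `DQGT1T2′` instance (generator B `ORBSYM`) certifies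
  exactly the same numbers; iterate one character at a time over the generators of `ℤ₂^m`.

Everything is PROVED (0 sorry, standard axioms); no definitions, no named facts; nothing asserts a bound
about any model; no claim node. NOT here: non-abelian point groups, general one-body unitary covariance.

References: M. Nakata, B. J. Braams, K. Fujisawa, M. Fukuda, J. K. Percus, M. Yamashita, Z. Zhao,
J. Chem. Phys. 128 (2008) 164113, §II.A–C (`T1`, `T2`, `T2′`); D. A. Mazziotti, in *Reduced-Density-Matrix
Mechanics*, Adv. Chem. Phys. 134 (Wiley 2007) ch. 3 §II.D.2 eqs. (37)–(45), §II.F eq. (95); K. Gatermann,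
P. A. Parrilo, J. Pure Appl. Algebra 192 (2004) 95–128, §3 Thm 3.3 (invariant SDPs lose nothing under
restriction to the fixed-point subspace).

Tree (REUSED): `t1Map_apply`, `t2Map_apply`, `t2PrimeMap`, `IsDQGT1T2PrimeFeasible(Sector)`
(`ThreeIndexRelaxationBound`); `sign_mul_self`, `star_sign`, `posSemidef_diagMul`, `isDQGFeasible_sign`,
`isDQGFeasibleSector_sign`, `rdmEnergy_sign` (`Rows/OrbitalSignBlockingLossless`);
`isDQGT1T2PrimeFeasibleSector_midpoint` (`Rows/SpinFlipQuotientLosslessT`); `rdmEnergy_midpoint`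
(`Rows/SpinFlipQuotientLossless`). Mathlib: `Matrix.one_apply`, `Matrix.fromBlocks_apply₁₁…₂₂`.
-/

noncomputable section

namespace Summit.Ventures.CertifiedQuantumChemistry

open Matrix Finset
open Literature.MathematicalPhysics.QuantumLattice Literature.MathematicalPhysics.QuantumChemistry
open scoped ComplexOrder

/-! ## §1 Covariance of the three-index maps under a sign congruence -/

section ThreeIndex

variable {ι : Type*} [LinearOrder ι]

/-- **Delta absorbs signs**: `δ_ab = χ_a χ_b δ_ab` for a sign character `χ = ±1` (if `a = b` the two
signs square to one). The right-hand delta is written as an entry of the identity matrix so that the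
rewrite terminates. -/
theorem ite_eq_sign_mul_one {χ : ι → ℂ} (hχ : ∀ i, χ i = 1 ∨ χ i = -1) (a b : ι) :
    (if a = b then (1 : ℂ) else 0) = χ a * χ b * (1 : Matrix ι ι ℂ) a b := by
  by_cases hab : a = b
  · subst hab
    rw [if_pos rfl, Matrix.one_apply_eq, mul_one, sign_mul_self hχ]
  · rw [if_neg hab, Matrix.one_apply_ne hab, mul_zero]

/-- **The `T1` functional is covariant under a sign congruence of the pair**: `T1` of the transformed
pair is `T1` conjugated by the diagonal sign `χ_i χ_j χ_k` (Nakata et al. 2008 §II.A, all 33 terms). -/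
theorem t1Map_sign {χ : ι → ℂ} (hχ : ∀ i, χ i = 1 ∨ χ i = -1) (γ : Matrix ι ι ℂ)
    (Γ : Matrix (ι × ι) (ι × ι) ℂ) :
    t1Map (Matrix.of fun i k => χ i * χ k * γ i k)
        (Matrix.of fun p q => χ p.1 * χ p.2 * (χ q.1 * χ q.2) * Γ p q) =
      Matrix.of fun p q => χ p.1 * χ p.2.1 * χ p.2.2 * (χ q.1 * χ q.2.1 * χ q.2.2) * t1Map γ Γ p q := by
  have hδ := ite_eq_sign_mul_one hχ
  have hone : ∀ a b : ι, (if a = b then (1 : ℂ) else 0) = (1 : Matrix ι ι ℂ) a b :=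
    fun a b => Matrix.one_apply.symm
  ext ⟨i, j, k⟩ ⟨l, m, n⟩
  rw [Matrix.of_apply, t1Map_apply, t1Map_apply]
  simp only [Matrix.of_apply]
  conv_lhs => simp only [hδ]
  conv_rhs => simp only [hone]
  ring

/-- **The `T2` functional is covariant under a sign congruence of the pair** (Nakata et al. 2008
§II.A, 7 terms), by the diagonal sign `χ_i χ_j χ_k`. -/
theorem t2Map_sign {χ : ι → ℂ} (hχ : ∀ i, χ i = 1 ∨ χ i = -1) (γ : Matrix ι ι ℂ)
    (Γ : Matrix (ι × ι) (ι × ι) ℂ) :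
    t2Map (Matrix.of fun i k => χ i * χ k * γ i k)
        (Matrix.of fun p q => χ p.1 * χ p.2 * (χ q.1 * χ q.2) * Γ p q) =
      Matrix.of fun p q => χ p.1 * χ p.2.1 * χ p.2.2 * (χ q.1 * χ q.2.1 * χ q.2.2) * t2Map γ Γ p q := by
  have hδ := ite_eq_sign_mul_one hχ
  have hone : ∀ a b : ι, (if a = b then (1 : ℂ) else 0) = (1 : Matrix ι ι ℂ) a b :=
    fun a b => Matrix.one_apply.symm
  ext ⟨i, j, k⟩ ⟨l, m, n⟩
  rw [Matrix.of_apply, t2Map_apply, t2Map_apply]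
  simp only [Matrix.of_apply]
  conv_lhs => simp only [hδ]
  conv_rhs => simp only [hone]
  ring

/-- **The `T2′` block matrix is covariant under a sign congruence of the pair** (Nakata et al. 2008
§II.B): the `(ijk)` block carries the sign `χ_i χ_j χ_k`, the one-index corner the sign `χ_l`, and the
off-diagonal blocks `X_{(ijk), l} = Γ^{ij}_{lk}` match because `Γ` carries exactly these four signs. -/
theorem t2PrimeMap_sign {χ : ι → ℂ} (hχ : ∀ i, χ i = 1 ∨ χ i = -1) (γ : Matrix ι ι ℂ)
    (Γ : Matrix (ι × ι) (ι × ι) ℂ) :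
    t2PrimeMap (Matrix.of fun i k => χ i * χ k * γ i k)
        (Matrix.of fun p q => χ p.1 * χ p.2 * (χ q.1 * χ q.2) * Γ p q) =
      Matrix.of fun P Q =>
        Sum.elim (fun I : ι × ι × ι => χ I.1 * χ I.2.1 * χ I.2.2) χ P *
          Sum.elim (fun I : ι × ι × ι => χ I.1 * χ I.2.1 * χ I.2.2) χ Q * t2PrimeMap γ Γ P Q := by
  ext (⟨i, j, k⟩ | l) (⟨l', m, n⟩ | m') <;>
    simp only [t2PrimeMap, Matrix.of_apply, fromBlocks_apply₁₁, fromBlocks_apply₁₂,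
      fromBlocks_apply₂₁, fromBlocks_apply₂₂, Sum.elim_inl, Sum.elim_inr]
  · rw [t2Map_sign hχ, Matrix.of_apply]
  · ring
  · ring

omit [LinearOrder ι] in
/-- The three-index diagonal sign is real. -/
theorem star_sign₃ {χ : ι → ℂ} (hχ : ∀ i, χ i = 1 ∨ χ i = -1) (I : ι × ι × ι) :
    star (χ I.1 * χ I.2.1 * χ I.2.2) = χ I.1 * χ I.2.1 * χ I.2.2 := by
  rw [star_mul', star_mul', star_sign hχ, star_sign hχ, star_sign hχ]

omit [LinearOrder ι] in
/-- The diagonal sign of the `T2′` index set `(ι × ι × ι) ⊕ ι` is real. -/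
theorem star_signSum {χ : ι → ℂ} (hχ : ∀ i, χ i = 1 ∨ χ i = -1) (P : (ι × ι × ι) ⊕ ι) :
    star (Sum.elim (fun I : ι × ι × ι => χ I.1 * χ I.2.1 * χ I.2.2) χ P) =
      Sum.elim (fun I : ι × ι × ι => χ I.1 * χ I.2.1 * χ I.2.2) χ P := by
  cases P with
  | inl I => simp only [Sum.elim_inl]; exact star_sign₃ hχ I
  | inr l => simp only [Sum.elim_inr]; exact star_sign hχ l

variable [Fintype ι]

/-- **`DQGT1T2′` feasibility (`N`-electron form) is invariant under a sign congruence**: the two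
three-index cones transform by real diagonal congruences (`posSemidef_diagMul`), the DQG part is
`isDQGFeasible_sign`. -/
theorem isDQGT1T2PrimeFeasible_sign {χ : ι → ℂ} (hχ : ∀ i, χ i = 1 ∨ χ i = -1) {N : ℕ}
    {γ : Matrix ι ι ℂ} {Γ : Matrix (ι × ι) (ι × ι) ℂ} (h : IsDQGT1T2PrimeFeasible N γ Γ) :
    IsDQGT1T2PrimeFeasible N (Matrix.of fun i k => χ i * χ k * γ i k)
      (Matrix.of fun p q => χ p.1 * χ p.2 * (χ q.1 * χ q.2) * Γ p q) where
  toIsDQGFeasible := isDQGFeasible_sign hχ h.toIsDQGFeasible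
  t1_psd := by
    rw [t1Map_sign hχ]
    exact posSemidef_diagMul h.t1_psd (fun I : ι × ι × ι => χ I.1 * χ I.2.1 * χ I.2.2) (star_sign₃ hχ)
  t2Prime_psd := by
    rw [t2PrimeMap_sign hχ]
    exact posSemidef_diagMul h.t2Prime_psd _ (star_signSum hχ)

end ThreeIndex

/-! ## §2 Sector rows and LOSSLESS sign blocking at the `DQGT1T2′` rung -/

section Sector

variable {Λ : Type*} [LinearOrder Λ] [Fintype Λ]

/-- **Sector-`DQGT1T2′` feasibility is invariant under a sign congruence** by signs `χ = ±1` on the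
spin orbitals (sector rows: `isDQGFeasibleSector_sign`; cones: `isDQGT1T2PrimeFeasible_sign`). -/
theorem isDQGT1T2PrimeFeasibleSector_sign {χ : Orb Λ → ℂ} (hχ : ∀ i, χ i = 1 ∨ χ i = -1) {a b : ℕ}
    {γ : Matrix (Orb Λ) (Orb Λ) ℂ} {Γ : Matrix (Orb Λ × Orb Λ) (Orb Λ × Orb Λ) ℂ}
    (h : IsDQGT1T2PrimeFeasibleSector a b γ Γ) :
    IsDQGT1T2PrimeFeasibleSector a b (Matrix.of fun i k => χ i * χ k * γ i k)
      (Matrix.of fun p q => χ p.1 * χ p.2 * (χ q.1 * χ q.2) * Γ p q) where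
  toIsDQGFeasibleSector := isDQGFeasibleSector_sign hχ h.toIsDQGFeasibleSector
  t1_psd := (isDQGT1T2PrimeFeasible_sign hχ h.isDQGT1T2PrimeFeasible).t1_psd
  t2Prime_psd := (isDQGT1T2PrimeFeasible_sign hχ h.isDQGT1T2PrimeFeasible).t2Prime_psd

/-- **LOSSLESS sign blocking, `DQGT1T2′` rung.** If the integral tables obey the selection rule of the
orbital signs `s = ±1`, every sector-`DQGT1T2′`-feasible pair has a SIGN-SYMMETRIC
sector-`DQGT1T2′`-feasible partner with the same energy: its `ℤ₂` average
`(½(γ + s·γ·s), ½(Γ + (s⊗s)·Γ·(s⊗s)))`, whose entries with an odd sign product vanish — imposing the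
§8 ORBSYM block structure as CONSTRAINTS on the `DQGT1T2′` instance loses nothing. -/
theorem exists_signSymmetric_of_isDQGT1T2PrimeFeasibleSector {s : Λ → ℂ}
    (hs : ∀ p, s p = 1 ∨ s p = -1) (h : Λ → Λ → ℂ) (g : Λ → Λ → Λ → Λ → ℂ) (hnuc : ℂ)
    (hh : ∀ p q, s p * s q ≠ 1 → h p q = 0)
    (hg : ∀ p q r t, s p * s r * (s q * s t) ≠ 1 → g p q r t = 0) {a b : ℕ}
    {γ : Matrix (Orb Λ) (Orb Λ) ℂ} {Γ : Matrix (Orb Λ × Orb Λ) (Orb Λ × Orb Λ) ℂ}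
    (hf : IsDQGT1T2PrimeFeasibleSector a b γ Γ) :
    ∃ (γ' : Matrix (Orb Λ) (Orb Λ) ℂ) (Γ' : Matrix (Orb Λ × Orb Λ) (Orb Λ × Orb Λ) ℂ),
      IsDQGT1T2PrimeFeasibleSector a b γ' Γ' ∧
      (∀ i k, s (ofLex i).1 * s (ofLex k).1 ≠ 1 → γ' i k = 0) ∧
      (∀ p q : Orb Λ × Orb Λ,
        s (ofLex p.1).1 * s (ofLex p.2).1 * (s (ofLex q.1).1 * s (ofLex q.2).1) ≠ 1 → Γ' p q = 0) ∧
      rdmEnergy h g hnuc γ' Γ' = rdmEnergy h g hnuc γ Γ := by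
  have hχ : ∀ i : Orb Λ, s (ofLex i).1 = 1 ∨ s (ofLex i).1 = -1 := fun i => hs _
  -- a sign product which is not `1` is `-1`
  have hpm : ∀ {z : ℂ}, (z = 1 ∨ z = -1) → z ≠ 1 → z = -1 := fun hz hz1 => hz.resolve_left hz1
  have hprod2 : ∀ i k : Orb Λ,
      s (ofLex i).1 * s (ofLex k).1 = 1 ∨ s (ofLex i).1 * s (ofLex k).1 = -1 := fun i k => by
    rcases hχ i with h1 | h1 <;> rcases hχ k with h2 | h2 <;> simp [h1, h2]
  have hprod4 : ∀ p q : Orb Λ × Orb Λ,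
      s (ofLex p.1).1 * s (ofLex p.2).1 * (s (ofLex q.1).1 * s (ofLex q.2).1) = 1 ∨
        s (ofLex p.1).1 * s (ofLex p.2).1 * (s (ofLex q.1).1 * s (ofLex q.2).1) = -1 := fun p q => by
    rcases hprod2 p.1 p.2 with h1 | h1 <;> rcases hprod2 q.1 q.2 with h2 | h2 <;> simp [h1, h2]
  refine ⟨(1 / 2 : ℂ) • (γ + Matrix.of fun i k => s (ofLex i).1 * s (ofLex k).1 * γ i k),
    (1 / 2 : ℂ) • (Γ + Matrix.of fun p q => s (ofLex p.1).1 * s (ofLex p.2).1 *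
      (s (ofLex q.1).1 * s (ofLex q.2).1) * Γ p q),
    isDQGT1T2PrimeFeasibleSector_midpoint hf (isDQGT1T2PrimeFeasibleSector_sign hχ hf),
    fun i k hik => ?_, fun p q hpq => ?_, ?_⟩
  · simp only [Matrix.smul_apply, Matrix.add_apply, Matrix.of_apply, hpm (hprod2 i k) hik]
    ring
  · simp only [Matrix.smul_apply, Matrix.add_apply, Matrix.of_apply, hpm (hprod4 p q) hpq]
    ring
  · rw [rdmEnergy_midpoint, rdmEnergy_sign h g hnuc hh hg]
    ring

/-- **The sign-blocked programme certifies the same numbers** (bound form, `DQGT1T2′` rung): with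
integral tables obeying the selection rule, a real number lies below the energy functional on ALL
sector-`DQGT1T2′`-feasible pairs iff it lies below it on the SIGN-SYMMETRIC ones. -/
theorem forall_isDQGT1T2PrimeFeasibleSector_iff_forall_signSymmetric {s : Λ → ℂ}
    (hs : ∀ p, s p = 1 ∨ s p = -1) (h : Λ → Λ → ℂ) (g : Λ → Λ → Λ → Λ → ℂ) (hnuc : ℂ)
    (hh : ∀ p q, s p * s q ≠ 1 → h p q = 0)
    (hg : ∀ p q r t, s p * s r * (s q * s t) ≠ 1 → g p q r t = 0) (a b : ℕ) (c : ℝ) :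
    (∀ γ Γ, IsDQGT1T2PrimeFeasibleSector a b γ Γ → c ≤ (rdmEnergy h g hnuc γ Γ).re) ↔
      ∀ γ Γ, IsDQGT1T2PrimeFeasibleSector a b γ Γ →
        (∀ i k, s (ofLex i).1 * s (ofLex k).1 ≠ 1 → γ i k = 0) →
        (∀ p q : Orb Λ × Orb Λ,
          s (ofLex p.1).1 * s (ofLex p.2).1 * (s (ofLex q.1).1 * s (ofLex q.2).1) ≠ 1 → Γ p q = 0) →
        c ≤ (rdmEnergy h g hnuc γ Γ).re := by
  refine ⟨fun hc γ Γ hf _ _ => hc γ Γ hf, fun hc γ Γ hf => ?_⟩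
  obtain ⟨γ', Γ', hf', hγ', hΓ', hE⟩ :=
    exists_signSymmetric_of_isDQGT1T2PrimeFeasibleSector hs h g hnuc hh hg hf
  rw [← hE]
  exact hc γ' Γ' hf' hγ' hΓ'

end Sector

end Summit.Ventures.CertifiedQuantumChemistry

end
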